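import Mathlib.Data.ENat.Lattice
import Literature.Computability.AlgebraicComplexity.ArithCircuit
import HarnessLib

/-!
# Syntactically multilinear arithmetic circuits (Raz–Yehudayoff 2008, §2) — fact-free definitions

The syntactic variable sets `X_v` of the gates of an arithmetic circuit (tree model
`Literature.Computability.AlgebraicComplexity.ArithCircuit`), the predicate
`IsSyntacticallyMultilinear` and the size measure `smCircuitSize`.

These eight declarations were first written in the barrier file
`Literature/Barriers/ValiantsHypothesis/FullRankMultilinear.lean`, next to the UNPROVED named
facts `RazYehudayoff2008_thm42`, `RazYehudayoff2008_smCircuit`, `AlonKumarVolk2020_thm20`; they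
are moved here VERBATIM (same names, same bodies, same universe parameters `u, v`; namespace
`Literature.Computability.AlgebraicComplexity`) so that routes and theorems can use the
syntactically multilinear model without importing any named fact (refactor item `wi-19992`;
the barrier file imports this one and re-exports the names into
`Literature.Barriers.ValiantsHypothesis`).

**The printed definition** (checked with `lit read` when the barrier was filed).
Raz–Yehudayoff, Comput. Complexity 17 (2008), §2: "An arithmetic circuit is called syntactically
multilinear if for every product gate `v` with sons `v₁, v₂`, `X_{v₁} ∩ X_{v₂} = ∅`" (where `X_v`
is the set of variables occurring in `Φ_v`; cf. §3: "every product gate … 'multiplies' disjoint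
sets of variables"). Alon–Kumar–Volk, Combinatorica 40 (2020), Thm. 1: lower bounds are for
the SIZE of syntactically multilinear circuits computing a given multilinear polynomial.

**Rendering.** `IsSyntacticallyMultilinear` computes the syntactic variable set `X_v` of every
gate by the same left fold as the semantics `ArithCircuit.gateValues` (junk forward references
contribute `∅`, matching their junk value `0`) and asks the operands of every product gate to have
pairwise disjoint variable sets (pairwise, for the tree's unbounded fan-in gates; equal to print
under `ArithCircuit.IsFanInTwo`); `smCircuitSize f : ℕ∞` is the least size (number of gates,
inputs and constants free) of a fan-in-two syntactically multilinear circuit computing `f`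
(`⊤` if there is none, e.g. for non-multilinear `f`).

## References

* [RazYehudayoff2008] R. Raz, A. Yehudayoff, *Balancing syntactically multilinear arithmetic
  circuits*, Comput. Complexity 17 (2008) 515–535, §2.
* [AlonKumarVolk2020] N. Alon, M. Kumar, B. L. Volk, *Unbalancing sets and an almost quadratic
  lower bound for syntactically multilinear arithmetic circuits*, Combinatorica 40 (2020), Thm. 1.
-/

noncomputable section

namespace Literature.Computability.AlgebraicComplexity

open MvPolynomial
open Literature.Computability.AlgebraicComplexity.ArithCircuit

universe u v

/-! ### Syntactically multilinear circuits (tree circuit model) -/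

section Syntactic

variable {k : Type u} {σ : Type v} [DecidableEq σ]

/-- The syntactic variable set of an operand, given the variable sets of the gates computed so
far (`var i ↦ {i}`, constants `↦ ∅`, `gate j ↦` the `j`-th set, junk references `↦ ∅`).
[cite: RazYehudayoff2008, §2 ("`X_v` the set of variables that occur in `Φ_v`")] -/
def operandVarSet (vs : List (Finset σ)) : Operand k σ → Finset σ
  | .var i => {i}
  | .const _ => ∅
  | .gate j => vs.getD j ∅

/-- The syntactic variable set of a gate: the union over its operands. [cite: RazYehudayoff2008, §2] -/
def gateVarSet (vs : List (Finset σ)) (g : Gate k σ) : Finset σ :=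
  (g.args.map (operandVarSet vs)).foldr (· ∪ ·) ∅

/-- The list of syntactic variable sets `X_v` of the gates of a circuit (left fold, as for the
semantics `ArithCircuit.gateValues`). [cite: RazYehudayoff2008, §2] -/
def gateVarSets (gs : List (Gate k σ)) : List (Finset σ) :=
  gs.foldl (fun vs g => vs ++ [gateVarSet vs g]) []

/-- **Syntactically multilinear circuit**: the operands of every product gate have pairwise
disjoint syntactic variable sets ("for every product gate `v` with sons `v₁, v₂`,
`X_{v₁} ∩ X_{v₂} = ∅`"; pairwise for the tree's unbounded fan-in gates).
[cite: RazYehudayoff2008, §2] -/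
def IsSyntacticallyMultilinear (P : ArithCircuit k σ) : Prop :=
  ∀ (i : ℕ) (args : List (Operand k σ)), P.gates[i]? = some (.prod args) →
    (args.map (operandVarSet (gateVarSets (P.gates.take i)))).Pairwise Disjoint

/-- A gate-free circuit (an input or a constant) is syntactically multilinear. [folklore] -/
theorem isSyntacticallyMultilinear_of_gates_eq_nil {P : ArithCircuit k σ} (h : P.gates = []) :
    IsSyntacticallyMultilinear P := by
  intro i args hi
  simp [h] at hi

variable [CommSemiring k]

/-- **Syntactically multilinear circuit size** of `f`: the least number of gates of a fan-in-two
syntactically multilinear circuit computing `f`, in `ℕ∞` (`⊤` if there is none, e.g. when `f` is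
not multilinear). Convention of the tree's `ArithCircuit.size`: inputs (variables and constants)
are free operands, only gates are counted — so a bare variable has size `0` (`smCircuitSize_X`),
not a defect but the count "number of gates". [cite: RazYehudayoff2008, §2] [cite: AlonKumarVolk2020, Thm. 1] -/
def smCircuitSize (f : MvPolynomial σ k) : ℕ∞ :=
  ⨅ (P : ArithCircuit k σ) (_ : P.IsFanInTwo ∧ IsSyntacticallyMultilinear P ∧ P.Computes f),
    (P.size : ℕ∞)

/-- The infimum is attained by every admissible circuit. [folklore] -/
theorem smCircuitSize_le {f : MvPolynomial σ k} {P : ArithCircuit k σ} (h2 : P.IsFanInTwo)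
    (hsm : IsSyntacticallyMultilinear P) (hf : P.Computes f) : smCircuitSize f ≤ P.size :=
  iInf₂_le P ⟨h2, hsm, hf⟩

/-- Variables have syntactically multilinear size `0` (inputs are free in the tree model). [folklore] -/
theorem smCircuitSize_X (i : σ) : smCircuitSize (X i : MvPolynomial σ k) = 0 :=
  nonpos_iff_eq_zero.mp (by
    simpa [ArithCircuit.size, ArithCircuit.ofVar] using
      smCircuitSize_le (f := (X i : MvPolynomial σ k)) (P := ofVar i)
        (fun g hg => by simp [ArithCircuit.ofVar] at hg)
        (isSyntacticallyMultilinear_of_gates_eq_nil rfl) rfl)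

end Syntactic

end Literature.Computability.AlgebraicComplexity

end
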